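import Summits.MatrixMultiplication.MatrixMultiplication.Theses.SaturationLadder
import Summits.MatrixMultiplication.MatrixMultiplication.Theorems.SaturationLadderExpSaturationEntropy


/-!
# `ExpSaturation` — the exponential-rate rung of route `SaturationLadder` (items
stmt-MatrixMultiplication-25913 `ExpSaturation`, hence stmt-MatrixMultiplication-24102 `EventualTightness`)

Decomposition cell `decomp-mm`, lens 1 (grading / quantitative ladder), generation 4.  PROOF, 0 sorry, of

* `ExpSaturation : ∀ t ∈ [0,1), ∃ r, 1 ≤ r ≤ 16 · 4^{1/(1−t)} ∧ ω(1, t, r) ≤ 1 + r` (aside, rank 9) and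
* `EventualTightness : ∀ t ∈ [0,1), ∃ r ≥ 1, ω(1, t, r) ≤ 1 + r` (its rate-free shadow),

of `Summits/MatrixMultiplication/MatrixMultiplication/Theses/SaturationLadder.lean`: the information
lower bound `ω(1, t, r) ≥ 1 + r` (Huang–Pan 1998 (2.8)) is ATTAINED at every `t < 1` from an `r(t)` that
is at most exponential in `1/(1−t)`.  (In print, exact tightness is known only inside the cone
`t ≤ α`, where already `ω(1, t, 1) = 2` — Huang–Pan 1998 Thm. 8.1 with Coppersmith's `α > 0.294` (1997),
today `α ≥ 0.321334` (Vassilevska Williams–Xu–Xu–Zhou 2024); tightness at EVERY `t < 1` with an explicit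
rate is, as far as the route header's literature census knows, not in print in this form.)

## The certificate: a one-parameter family of X-perfect first-power `CW_q` laser methods

For integers `q ≥ 2`, `k ≥ 1`, `c` with `qk = k + 1 + c`, run the FIRST-POWER laser method on the
Coppersmith–Winograd tensor `CW_q` (`R̃(CW_q) ≤ q + 2`) through the tree's proved pipeline for crux
`PerfectAmortisation` (`Theorems/ShapeSubmodularityPerfectAmortisation*.lean`, here only its restriction
step `stub_cwRectRestriction`) with the joint type

  `Q = (m(k+1) on (1,1,0), mk on (0,1,1), mc on (1,0,1), mk on (2,0,0))`, `N = (3k+1+c)m = (q+2)km`,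

i.e. the law `P = (p − θ, θ, 1 − θ − p, θ)` with `θ = 1/(q+2)`, `p = (2k+1)/((q+2)k)`; marginals
`X = (θ, 1 − 2θ, θ)`, `Y = (1 − p, p, 0)`, `Z = (p, 1 − p, 0)`.

* `stub_cwRectRestriction` (tree): a free diagonal `Δ` of type `Q` gives
  `CW_q^{⊗N} ≥ ⟨|Δ|⟩ ⊗ ⟨q^{m(k+1)}, q^{mk}, q^{mc}⟩`;
* `exists_free_diagonal_jointType_card` (tree, Le Gall 2014 App. A): a free `Δ` with
  `2^{N (min_m H(P_m) − Γ_S(P))} ≤ |Δ| · (N+1)^63 · 192 · exp(4 √(log 6 + N log 27))`;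
* entropy evaluation (this file, symbolic in `q, k`): `Γ_S(P) = 0` because a law on `{i+j+l = 2}` with
  these marginals has no mass on `(0,2,0), (0,0,2)` (`Y₂ = Z₂ = 0`) and is then determined
  (`D(P) = {P}`); and `min_m H(P_m) = H(X) = log(q+2) − (q/(q+2)) log q` (nats) PROVIDED the
  ENTROPY CONDITION `2 η(θ) + η(1 − 2θ) ≤ h(p)` holds (`η = −x log x`, `h` = binary entropy);
* X-PERFECTNESS: `N · H(X) = N log(q+2) − qkm log q` EXACTLY, so the packing certificate reads
  `(q+2)^N ≤ |Δ| · (q^m)^{qk+δ}` for `m ≥ m₀(δ)` (only the subexponential loss is absorbed);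
* `advxxz2025_thm32` (tree, ADVXXZ 2025 Thm. 3.2):
  `|Δ| · (q^m)^{ω(k+1,k,c)} ≤ R̃(⟨|Δ|⟩ ⊗ ⟨(q^m)^{k+1}, (q^m)^k, (q^m)^c⟩) ≤ R̃(CW_q^{⊗N}) ≤ (q+2)^N`,
  whence **`ω(k+1, k, c) ≤ qk = (k+1) + c`**, i.e. (homogeneity, Lotti–Romani 1983)
  **`ω(1, k/(k+1), c/(k+1)) ≤ 1 + c/(k+1)`**: the bound is tight at `t = k/(k+1)`, `r = c/(k+1)`.

The entropy condition in closed form (`entropyX_le_binEntropy_of`): with `p = lθ`, it follows from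
`l log l + l²θ ≤ (l − 2)(1 + log(1/θ))` via `−log(1−2θ) ≤ 2θ/(1−2θ)` and `−log(1−p) ≥ p`; at
`q = 4^{k+2}`, `l = 2 + 1/k` this reduces (`entropyNum`) to `1/2 + 9/64 ≤ 3 log 2`.  Hence
(`tight_grade`) for every `k ≥ 1`:

  `T(k/(k+1), r_k)`, `r_k = (4^{k+2} k − k − 1)/(k+1) < 4^{k+2} = 16 · 4^k`.

Given `t ∈ [0,1)` take `k = max(1, ⌈t/(1−t)⌉) ≤ 1/(1−t)`: `t ≤ k/(k+1)` (monotonicity of `ω(1,·,r)`),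
`1 ≤ r_k ≤ 16 · 4^{1/(1−t)}` — this is `ExpSaturation`, and `EventualTightness` drops the rate.
COROLLARY toward the rank-2 crux `SubexpSaturation = ∀ c > 0, ∃ t₀ < 1, ∀ t ∈ [t₀,1), ∃ r ≤ e^{c/(1−t)}, …`
(`subexpSaturation_above_log_four`): every clause with `c > log 4` HOLDS (`16 · 4^{1/(1−t)} ≤ e^{c/(1−t)}`
once `(1−t) log 16 ≤ c − log 4`); the open residue of the crux is `c ∈ (0, log 4]`, and `log 4` is the
cell census's measured onset constant of the full first-power `CW_q` method (H2) — the grade where the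
theorems of this method class stop.

References: Coppersmith–Winograd 1990 §6–§7 [CoppersmithWinograd1990]; Le Gall, ISSAC 2014, App. A
[LeGall2014]; Alman–Duan–Vassilevska Williams–Xu–Xu–Zhou, SODA 2025, Thm. 3.2
[AlmanDuanVassilevskaWilliamsXuXuZhou2025]; Huang–Pan 1998 §2 (2.8), Thm. 8.1 [HuangPan1998]; Vassilevska Williams–Xu–Xu–Zhou 2024 (α ≥ 0.321334) [VassilevskaWilliamsXuXuZhou2024];
Lotti–Romani 1983 [LottiRomani1983]; Coppersmith 1997 [Coppersmith1997].
No new definitions, no named facts, no sorry.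

Landing note: the lens-1 kernel `ExpSaturation.lean` (decomp-mm gen 4; sha256 de524bf9…328c, 913 lines,
rc 0 · 0 sorry · std axioms, critic-endorsed 2026-08-30T04:10:26Z) is landed as three files for the gate rule
«Theorems files with proofs ≤ 400 lines» — `SaturationLadderExpSaturationDiagonal` (layers B1, B2),
`SaturationLadderExpSaturationEntropy` (the entropy inequality in closed form, `famEntropy`, `famDiagonal`,
layer C `famThreshold`) and `SaturationLadderExpSaturation` (assembly `ω(k+1,k,c) ≤ qk`, the entropy condition at
`q = 4^(k+2)`, the closers `expSaturation_holds` / `eventualTightness_holds`, and `subexpSaturation_above_log_four`);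
statements and proofs are unchanged (one namespace `…Theorems.SaturationLadderExpSaturation` throughout), except
that the two folklore identities `H(1−p,p,0) = H(p,1−p,0) = h(p)/log 2` — verbatim the tree's
`PerfectAmortisation.shannonEntropy_vec3_eq_binEntropy'` / `…_eq_binEntropy`, whose module
`Theorems/ShapeSubmodularityPerfectAmortisationStubCwRectEntropy.lean` has no farm olean at landing time
(rc 75 `remote:stale:unbuilt`) — are proved locally inside `famEntropy` instead of being restated
(gate rule `dedup.landed`); the helper files import no route (`Theses`) file (gate lint `theses-cone`).
-/

set_option linter.dupNamespace false
-- (single-conjunct summit: the namespace repeats `MatrixMultiplication`)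

noncomputable section

open Finset
open scoped BigOperators

namespace Summit.MatrixMultiplication.MatrixMultiplication.Theorems.SaturationLadderExpSaturation

open Literature.Computability.AlgebraicComplexity
open Literature.Barriers.MatrixMultiplication
open Summit.MatrixMultiplication.MatrixMultiplication.Theorems.PerfectAmortisation
  (stub_cwRectRestriction)

/-! ## Assembly: `ω(k+1, k, c) ≤ qk` for the whole family -/

/-- Transport of `R̃(⟨V⟩ ⊗ ⟨k,l,n⟩)` along equalities of the three dimensions. [folklore] -/
theorem asymptoticRank_multiple_matMulTensor_congr {V k k' l l' n n' : ℕ} (hk : k = k')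
    (hl : l = l') (hn : n = n') :
    asymptoticRank (kroneckerTensor (unitTensor ℂ V) (matMulTensor ℂ k l n)) =
      asymptoticRank (kroneckerTensor (unitTensor ℂ V) (matMulTensor ℂ k' l' n')) := by
  subst hk; subst hl; subst hn; rfl

/-- **`ω(k+1, k, c) ≤ qk` whenever `qk = k+1+c` and the family's entropy condition holds** — the
first-power `CW_q` laser method with the `X`-perfect joint type `(k+1, k, c, k)/((q+2)k)`:
for every `δ > 0`, `|Δ| · (q^m)^{ω(k+1,k,c)} ≤ R̃(⟨|Δ|⟩ ⊗ ⟨q^{m(k+1)}, q^{mk}, q^{mc}⟩) ≤ R̃(CW_q^{⊗(q+2)km})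
≤ (q+2)^{(q+2)km} ≤ |Δ| · (q^m)^{qk+δ}`. [cite: AlmanDuanVassilevskaWilliamsXuXuZhou2025, Thm. 3.2]
[cite: LeGall2014, Appendix A] -/
theorem omegaRect_cwFamily_le (q k c : ℕ) (hq : 2 ≤ q) (hk : 1 ≤ k) (hqk : q * k = k + 1 + c)
    (hent : 2 * Real.negMulLog (1 / ((q : ℝ) + 2)) + Real.negMulLog (1 - 2 * (1 / ((q : ℝ) + 2))) ≤
      Real.binEntropy ((2 * k + 1) / (((q : ℝ) + 2) * k))) :
    omegaRect ℂ ((k : ℝ) + 1) k c ≤ (q : ℝ) * k := by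
  refine le_of_forall_pos_lt_add fun δ hδ => ?_
  obtain ⟨m, hm, hT⟩ := famThreshold q k hq hk (δ / 2) (half_pos hδ)
  obtain ⟨Δ, hS, hcnt, hfree, hsize⟩ := famDiagonal q k c m hq hk hm hqk hent
  have hres := stub_cwRectRestriction q (m * (k + 1)) (m * k) (m * c) ((q + 2) * k * m) Δ hS hcnt hfree
  have hV : 1 ≤ Δ.card := by
    by_contra h0
    have h0' : Δ.card = 0 := by omega
    rw [h0', Nat.cast_zero, zero_mul, zero_mul, zero_mul] at hsize
    exact absurd hsize (not_le.2 (Real.exp_pos _))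
  have hnum := hT Δ.card hsize
  have hm0 : m ≠ 0 := by omega
  have hqle : q ≤ q ^ m := Nat.le_self_pow hm0 q
  have hq2 : 2 ≤ q ^ m := hq.trans hqle
  -- the general-format asymptotic sum inequality (ADVXXZ 2025, Thm. 3.2) at `q^m`, `(a,b,c) = (k+1,k,c)`
  have hasi := advxxz2025_thm32 ℂ hq2 (k + 1) k c hV
  rw [asymptoticRank_multiple_matMulTensor_congr (pow_mul q m (k + 1)).symm (pow_mul q m k).symm
    (pow_mul q m c).symm] at hasi
  push_cast at hasi
  -- `R̃(⟨V⟩ ⊗ ⟨q^{m(k+1)}, q^{mk}, q^{mc}⟩) ≤ R̃(CW_q^{⊗N}) ≤ (q+2)^N`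
  have h2 := asymptoticRank_le_of_polyDegeneratesTo hres.polyDegeneratesTo
  have hcw : asymptoticRank (bigCwTensor ℂ q) ≤ (q : ℝ) + 2 := by
    exact_mod_cast asymptoticRank_bigCwTensor_le ℂ q
  have hNpos : 0 < (q + 2) * k * m := Nat.mul_pos (Nat.mul_pos (by omega) (by omega)) (by omega)
  have h3 : asymptoticRank (kroneckerPow (bigCwTensor ℂ q) ((q + 2) * k * m)) ≤
      ((q : ℝ) + 2) ^ ((q + 2) * k * m) :=
    (asymptoticRank_kroneckerPow_le (bigCwTensor ℂ q) hNpos).trans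
      (pow_le_pow_left₀ (asymptoticRank_nonneg _) hcw ((q + 2) * k * m))
  have hchain : (Δ.card : ℝ) * ((q : ℝ) ^ m) ^ omegaRect ℂ ((k : ℝ) + 1) k c ≤
      (Δ.card : ℝ) * ((q : ℝ) ^ m) ^ ((q : ℝ) * k + δ / 2) :=
    hasi.trans (h2.trans (h3.trans hnum))
  have hV0 : (0 : ℝ) < Δ.card := by exact_mod_cast hV
  have h4 : ((q : ℝ) ^ m) ^ omegaRect ℂ ((k : ℝ) + 1) k c ≤ ((q : ℝ) ^ m) ^ ((q : ℝ) * k + δ / 2) :=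
    le_of_mul_le_mul_left hchain hV0
  have hq1 : (1 : ℝ) < (q : ℝ) ^ m := by
    have h : ((2 : ℕ) : ℝ) ≤ ((q ^ m : ℕ) : ℝ) := by exact_mod_cast hq2
    push_cast at h
    linarith
  have h5 : omegaRect ℂ ((k : ℝ) + 1) k c ≤ (q : ℝ) * k + δ / 2 :=
    (Real.rpow_le_rpow_left_iff hq1).1 h4
  linarith

/-- **Tightness of the information bound along the family**: `ω(1, k/(k+1), c/(k+1)) ≤ 1 + c/(k+1)`
whenever `qk = k+1+c` and the entropy condition holds (`ω(k+1,k,c) = (k+1) ω(1, k/(k+1), c/(k+1))`,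
homogeneity, Lotti–Romani 1983). [cite: LottiRomani1983, §1 (p. 173)] -/
theorem tight_cwFamily (q k c : ℕ) (hq : 2 ≤ q) (hk : 1 ≤ k) (hqk : q * k = k + 1 + c)
    (hent : 2 * Real.negMulLog (1 / ((q : ℝ) + 2)) + Real.negMulLog (1 - 2 * (1 / ((q : ℝ) + 2))) ≤
      Real.binEntropy ((2 * k + 1) / (((q : ℝ) + 2) * k))) :
    omegaRect ℂ 1 ((k : ℝ) / ((k : ℝ) + 1)) ((c : ℝ) / ((k : ℝ) + 1)) ≤ 1 + (c : ℝ) / ((k : ℝ) + 1) := by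
  have h := omegaRect_cwFamily_le q k c hq hk hqk hent
  have hk1 : (0 : ℝ) < (k : ℝ) + 1 := by positivity
  have hhom := LottiRomani1983_homogeneous ℂ hk1.le zero_le_one
    (by positivity : (0 : ℝ) ≤ (k : ℝ) / ((k : ℝ) + 1)) (by positivity : (0 : ℝ) ≤ (c : ℝ) / ((k : ℝ) + 1))
  have e : omegaRect ℂ ((k : ℝ) + 1) k c = omegaRect ℂ (((k : ℝ) + 1) * 1)
      (((k : ℝ) + 1) * ((k : ℝ) / ((k : ℝ) + 1))) (((k : ℝ) + 1) * ((c : ℝ) / ((k : ℝ) + 1))) := by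
    rw [mul_one, mul_div_cancel₀ _ hk1.ne', mul_div_cancel₀ _ hk1.ne']
  rw [e, hhom] at h
  have hc' : (q : ℝ) * k = (k : ℝ) + 1 + c := by exact_mod_cast hqk
  refine le_of_mul_le_mul_left ?_ hk1
  calc ((k : ℝ) + 1) * omegaRect ℂ 1 ((k : ℝ) / ((k : ℝ) + 1)) ((c : ℝ) / ((k : ℝ) + 1))
      ≤ (q : ℝ) * k := h
    _ = ((k : ℝ) + 1) * (1 + (c : ℝ) / ((k : ℝ) + 1)) := by
        rw [hc', mul_add, mul_one, mul_div_cancel₀ _ hk1.ne']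

/-! ## The entropy condition for `q = 4^(k+2)` and the route items -/

/-- **The entropy condition holds at `q = 4^(k+2)`** (`k ≥ 1`): with `θ = 1/(q+2)`,
`p = (2k+1)/((q+2)k) = (2 + 1/k) θ`, `2 η(θ) + η(1 − 2θ) ≤ h(p)`. [folklore] -/
theorem entropyCondition_four_pow (k : ℕ) (hk : 1 ≤ k) (q : ℕ) (hq : q = 4 ^ (k + 2)) :
    2 * Real.negMulLog (1 / ((q : ℝ) + 2)) + Real.negMulLog (1 - 2 * (1 / ((q : ℝ) + 2))) ≤
      Real.binEntropy ((2 * k + 1) / (((q : ℝ) + 2) * k)) := by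
  have hk0 : (0 : ℝ) < k := by exact_mod_cast hk
  have hk1 : (1 : ℝ) ≤ k := by exact_mod_cast hk
  have hqR : (q : ℝ) = (4 : ℝ) ^ (k + 2) := by rw [hq]; push_cast; ring
  have hq16 : (16 : ℝ) ≤ q := by
    rw [hqR]
    have : (4 : ℝ) ^ 2 ≤ (4 : ℝ) ^ (k + 2) := pow_le_pow_right₀ (by norm_num) (by omega)
    linarith
  have hq2 : (0 : ℝ) < (q : ℝ) + 2 := by linarith
  refine entropyX_le_binEntropy_of (l := 2 + 1 / (k : ℝ)) (by positivity) ?_ ?_ ?_ ?_ ?_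
  · rw [show 2 * (1 / ((q : ℝ) + 2)) = 2 / ((q : ℝ) + 2) by ring, div_lt_one hq2]
    linarith
  · field_simp
  · have : 0 ≤ 1 / (k : ℝ) := by positivity
    linarith
  · rw [div_lt_one (by positivity)]
    nlinarith
  · exact entropyNum k hk hqR.symm.le

/-- **The graded certificate**: for every `k ≥ 1`, with `q = 4^(k+2)` and `c = qk − k − 1`,
`ω(1, k/(k+1), c/(k+1)) ≤ 1 + c/(k+1)` — the information bound `ω(1,t,r) ≥ 1 + r` is tight at
`t = k/(k+1)` from `r = (4^(k+2) k − k − 1)/(k+1) < 4^(k+2)` on.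
[cite: AlmanDuanVassilevskaWilliamsXuXuZhou2025, Thm. 3.2] [cite: HuangPan1998, §2 (2.8)] -/
theorem tight_grade (k : ℕ) (hk : 1 ≤ k) :
    omegaRect ℂ 1 ((k : ℝ) / ((k : ℝ) + 1)) (((4 ^ (k + 2) * k - (k + 1) : ℕ) : ℝ) / ((k : ℝ) + 1)) ≤
      1 + ((4 ^ (k + 2) * k - (k + 1) : ℕ) : ℝ) / ((k : ℝ) + 1) := by
  have h16 : 16 ≤ 4 ^ (k + 2) := by
    have := Nat.pow_le_pow_right (by norm_num : 0 < 4) (by omega : 2 ≤ k + 2)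
    simpa using this
  have hqk : 4 ^ (k + 2) * k = k + 1 + (4 ^ (k + 2) * k - (k + 1)) := by
    have : k + 1 ≤ 4 ^ (k + 2) * k := by nlinarith
    omega
  exact tight_cwFamily (4 ^ (k + 2)) k _ (le_trans (by norm_num) h16) hk hqk
    (entropyCondition_four_pow k hk _ rfl)

/-- Admissible exponents are antitone in the three format exponents (padding,
`tensorRank_matMulTensor_mono₃`). [folklore] -/
theorem rectAdmissibleExponents_anti {a a' b b' c c' : ℝ} (ha : a ≤ a') (hb : b ≤ b') (hc : c ≤ c') :
    rectAdmissibleExponents ℂ a' b' c' ⊆ rectAdmissibleExponents ℂ a b c := by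
  intro β hβ
  refine Asymptotics.IsBigO.trans ?_ hβ
  refine Asymptotics.IsBigO.of_bound 1 ?_
  filter_upwards [Filter.eventually_ge_atTop 1] with n hn
  rw [one_mul, Real.norm_of_nonneg (Nat.cast_nonneg _), Real.norm_of_nonneg (Nat.cast_nonneg _)]
  exact_mod_cast tensorRank_matMulTensor_mono₃ ℂ (rectDim_mono hn ha) (rectDim_mono hn hb)
    (rectDim_mono hn hc)

/-- `ω(a,b,c) ≤ ω(a',b',c')` for `a ≤ a'`, `b ≤ b'`, `c ≤ c'`. [folklore] -/
theorem omegaRect_mono' {a a' b b' c c' : ℝ} (ha : a ≤ a') (hb : b ≤ b') (hc : c ≤ c') :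
    omegaRect ℂ a b c ≤ omegaRect ℂ a' b' c' :=
  csInf_le_csInf (rectAdmissibleExponents_bddBelow ℂ a b c)
    (rectAdmissibleExponents_nonempty ℂ a' b' c') (rectAdmissibleExponents_anti ha hb hc)

/-- **Item stmt-MatrixMultiplication-25913 `ExpSaturation`**: for every `t ∈ [0,1)` there is
`r ∈ [1, 16 · 4^{1/(1−t)}]` with `ω(1, t, r) ≤ 1 + r`.  Witness: `k = max(1, ⌈t/(1−t)⌉) ≤ 1/(1−t)`,
`q = 4^(k+2) = 16 · 4^k`, `r = (qk − k − 1)/(k+1) < q`; `t ≤ k/(k+1)` and monotonicity in the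
middle slot. [cite: AlmanDuanVassilevskaWilliamsXuXuZhou2025, Thm. 3.2] [cite: LeGall2014, Appendix A] -/
theorem expSaturation_holds :
    Summit.MatrixMultiplication.MatrixMultiplication.Theses.SaturationLadder.ExpSaturation := by
  intro t ht0 ht1
  have h1t : 0 < 1 - t := by linarith
  have hx0 : 0 ≤ t / (1 - t) := div_nonneg ht0 h1t.le
  -- the grade `k`
  obtain ⟨k, hkdef⟩ : ∃ k : ℕ, k = max 1 ⌈t / (1 - t)⌉₊ := ⟨_, rfl⟩
  have hk : 1 ≤ k := hkdef ▸ le_max_left _ _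
  have hkceil : ⌈t / (1 - t)⌉₊ ≤ k := hkdef ▸ le_max_right _ _
  have hk0 : (0 : ℝ) < k := by exact_mod_cast hk
  have hk_le : (k : ℝ) ≤ 1 / (1 - t) := by
    have h1 : ((⌈t / (1 - t)⌉₊ : ℕ) : ℝ) ≤ t / (1 - t) + 1 := (Nat.ceil_lt_add_one hx0).le
    have h2 : (k : ℝ) ≤ t / (1 - t) + 1 := by
      rw [hkdef, Nat.cast_max, Nat.cast_one]
      exact max_le (by linarith) h1
    have e : t / (1 - t) + 1 = 1 / (1 - t) := by
      field_simp
      ring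
    linarith [e.le]
  have ht_le : t ≤ (k : ℝ) / ((k : ℝ) + 1) := by
    have hceil : t / (1 - t) ≤ (k : ℝ) := (Nat.le_ceil _).trans (by exact_mod_cast hkceil)
    rw [div_le_iff₀ h1t] at hceil
    rw [le_div_iff₀ (by positivity)]
    nlinarith
  -- the tensor `CW_q`, `q = 4^(k+2)`, and the third exponent `c = qk − k − 1`
  have h16 : 16 ≤ 4 ^ (k + 2) := by
    have := Nat.pow_le_pow_right (by norm_num : 0 < 4) (by omega : 2 ≤ k + 2)
    simpa using this
  have hc2 : 2 * (k + 1) ≤ 4 ^ (k + 2) * k := by nlinarith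
  have hT := tight_grade k hk
  refine ⟨(((4 ^ (k + 2) * k - (k + 1) : ℕ) : ℝ)) / ((k : ℝ) + 1), ?_, ?_, ?_⟩
  · -- `1 ≤ r`
    rw [le_div_iff₀ (by positivity), one_mul]
    have : k + 1 ≤ 4 ^ (k + 2) * k - (k + 1) := by omega
    exact_mod_cast this
  · -- `r ≤ 16 · 4^{1/(1−t)}`
    have hr_le_q : (((4 ^ (k + 2) * k - (k + 1) : ℕ) : ℝ)) / ((k : ℝ) + 1) ≤ ((4 ^ (k + 2) : ℕ) : ℝ) := by
      rw [div_le_iff₀ (by positivity)]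
      have h1 : (((4 ^ (k + 2) * k - (k + 1) : ℕ) : ℝ)) ≤ ((4 ^ (k + 2) * k : ℕ) : ℝ) := by
        exact_mod_cast Nat.sub_le _ _
      have h2 : (0 : ℝ) ≤ ((4 ^ (k + 2) : ℕ) : ℝ) := Nat.cast_nonneg _
      push_cast at h1 h2 ⊢
      nlinarith
    have hq_eq : ((4 ^ (k + 2) : ℕ) : ℝ) = 16 * (4 : ℝ) ^ (k : ℝ) := by
      push_cast
      rw [Real.rpow_natCast]
      ring
    have hmono : (4 : ℝ) ^ (k : ℝ) ≤ (4 : ℝ) ^ (1 / (1 - t)) :=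
      Real.rpow_le_rpow_of_exponent_le (by norm_num) hk_le
    calc (((4 ^ (k + 2) * k - (k + 1) : ℕ) : ℝ)) / ((k : ℝ) + 1) ≤ ((4 ^ (k + 2) : ℕ) : ℝ) := hr_le_q
      _ = 16 * (4 : ℝ) ^ (k : ℝ) := hq_eq
      _ ≤ 16 * (4 : ℝ) ^ (1 / (1 - t)) := by linarith
  · -- `ω(1, t, r) ≤ ω(1, k/(k+1), r) ≤ 1 + r`
    exact (omegaRect_mono' le_rfl ht_le le_rfl).trans hT

/-- **Item stmt-MatrixMultiplication-24102 `EventualTightness`**: for every `t ∈ [0,1)` the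
information bound `ω(1, t, r) ≥ 1 + r` (Huang–Pan 1998 (2.8)) is attained by SOME `r ≥ 1` — from
`ExpSaturation` (drop the rate). [cite: HuangPan1998, §2 (2.8)] -/
theorem eventualTightness_holds :
    Summit.MatrixMultiplication.MatrixMultiplication.Theses.SaturationLadder.EventualTightness := by
  intro t ht0 ht1
  obtain ⟨r, hr, -, hT⟩ := expSaturation_holds t ht0 ht1
  exact ⟨r, hr, hT⟩

/-- `ExpSaturation → EventualTightness` (the level-`1` edge of the `c`-graded pricing of
`SubexpSaturation`; kernel). [folklore] -/
theorem eventualTightness_of_expSaturation :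
    Summit.MatrixMultiplication.MatrixMultiplication.Theses.SaturationLadder.ExpSaturation →
      Summit.MatrixMultiplication.MatrixMultiplication.Theses.SaturationLadder.EventualTightness := by
  intro h t ht0 ht1
  obtain ⟨r, hr, -, hT⟩ := h t ht0 ht1
  exact ⟨r, hr, hT⟩

/-- **The `c > log 4` part of crux `SubexpSaturation` (stmt-MatrixMultiplication-25909), kernel**:
for every `c > log 4` there is `t₀ < 1` such that every `t ∈ [t₀, 1)` admits `r ∈ [1, e^{c/(1−t)}]`
with `ω(1, t, r) ≤ 1 + r` — from `ExpSaturation`, since `16 · 4^{1/(1−t)} ≤ e^{c/(1−t)}` as soon as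
`(1−t) log 16 ≤ c − log 4`.  The grade where the theorems stop is `c* = log 4` (the cell census's
measured onset constant of the full first-power `CW_q` method, H2): `SubexpSaturation` is exactly
`∀ c > 0`, and the clauses `c ∈ (0, log 4]` are the open residue of the crux. [folklore] -/
theorem subexpSaturation_above_log_four :
    ∀ c : ℝ, Real.log 4 < c → ∃ t₀ : ℝ, t₀ < 1 ∧ ∀ t : ℝ, t₀ ≤ t → t < 1 →
      ∃ r : ℝ, 1 ≤ r ∧ r ≤ Real.exp (c / (1 - t)) ∧ omegaRect ℂ 1 t r ≤ 1 + r := by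
  intro c hc
  have h16 : 0 < Real.log 16 := Real.log_pos (by norm_num)
  refine ⟨max 0 (1 - (c - Real.log 4) / Real.log 16), ?_, ?_⟩
  · refine max_lt one_pos ?_
    have : 0 < (c - Real.log 4) / Real.log 16 := div_pos (by linarith) h16
    linarith
  · intro t ht0 ht1
    have ht0' : 0 ≤ t := le_trans (le_max_left _ _) ht0
    have ht2 : 1 - (c - Real.log 4) / Real.log 16 ≤ t := le_trans (le_max_right _ _) ht0
    have h1t : 0 < 1 - t := by linarith
    obtain ⟨r, hr1, hrle, hT⟩ := expSaturation_holds t ht0' ht1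
    refine ⟨r, hr1, hrle.trans ?_, hT⟩
    -- `16 · 4^{1/(1−t)} ≤ exp (c/(1−t))`
    have e : (16 : ℝ) * (4 : ℝ) ^ (1 / (1 - t)) =
        Real.exp (Real.log 16 + Real.log 4 * (1 / (1 - t))) := by
      rw [Real.exp_add, Real.exp_log (by norm_num : (0 : ℝ) < 16),
        Real.rpow_def_of_pos (by norm_num : (0 : ℝ) < 4)]
    rw [e, Real.exp_le_exp]
    have key : (1 - t) * Real.log 16 ≤ c - Real.log 4 := by
      have h' : 1 - t ≤ (c - Real.log 4) / Real.log 16 := by linarith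
      rw [le_div_iff₀ h16] at h'
      linarith
    rw [← sub_nonneg]
    have e2 : c / (1 - t) - (Real.log 16 + Real.log 4 * (1 / (1 - t))) =
        ((c - Real.log 4) - (1 - t) * Real.log 16) / (1 - t) := by
      field_simp
      ring
    rw [e2]
    exact div_nonneg (by linarith) h1t.le

/-- The same, phrased on the route's decl: `ExpSaturation` settles every clause `c > log 4` of
`SubexpSaturation` (`= ∀ c > 0, …`). [folklore] -/
theorem subexpSaturation_clause_of_gt_log_four (c : ℝ) (hc : Real.log 4 < c) :
    ∃ t₀ : ℝ, t₀ < 1 ∧ ∀ t : ℝ, t₀ ≤ t → t < 1 → ∃ r : ℝ, 1 ≤ r ∧ r ≤ Real.exp (c / (1 - t)) ∧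
      Literature.Computability.AlgebraicComplexity.omegaRect ℂ 1 t r ≤ 1 + r :=
  subexpSaturation_above_log_four c hc

end Summit.MatrixMultiplication.MatrixMultiplication.Theorems.SaturationLadderExpSaturation

end
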